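import Summits.PneNP.PneNP.Theorems.PermanentDescentUniformizationUnderCollapse
import Literature.Computability.Complexity.CircuitEval

/-!
# Route PermanentDescent — the crux `CollapseMakesPermanentEasy` IS its non-uniform core `CollapseShrinksPermanent`

With the uniform half `UniformizationUnderCollapse` (stmt-PneNP-16145) PROVED
(`Summit.PneNP.PneNP.Theorems.uniformizationUnderCollapse_proof`), the crux `CollapseMakesPermanentEasy`
(stmt-PneNP-16142: `NP ⊆ P → PermBits ∈ P`) and the support `CollapseShrinksPermanent` (stmt-PneNP-16144:
`NP ⊆ P → PermBits ∈ P/poly`) are EQUIVALENT statements: `→` by `P ⊆ P/poly` (`P_subset_PPoly_holds`,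
Arora–Barak Thm. 6.6), `←` by uniformization. So the open content of the crux is exactly item 16144
(line `birth`, skeleton v3: one stub left). This file imports only the landed uniformization theorem and
`CircuitEval` (for `P_subset_PPoly_holds`).
-/

set_option linter.dupNamespace false -- `Summit.PneNP.PneNP.…`: summit = sub-problem name (D-0017 single-conjunct layout)

namespace Summit.PneNP.PneNP.Theorems

open Literature.Computability.Complexity Summit.PneNP.PneNP.Theses.PermanentDescent

/-- **The crux follows from its non-uniform core** (and the proved uniform half):
`CollapseShrinksPermanent → CollapseMakesPermanentEasy`, by `fun h => U h (k h)` with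
`U = uniformizationUnderCollapse_proof`. [folklore] -/
theorem collapseMakesPermanentEasy_of_collapseShrinksPermanent
    (k : CollapseShrinksPermanent) : CollapseMakesPermanentEasy := by
  unfold CollapseMakesPermanentEasy
  unfold CollapseShrinksPermanent at k
  have u := uniformizationUnderCollapse_proof
  unfold UniformizationUnderCollapse at u
  exact fun h => u h (k h)

/-- **The non-uniform core follows from the crux**: `CollapseMakesPermanentEasy → CollapseShrinksPermanent`,
since `P ⊆ P/poly` (`P_subset_PPoly_holds`). [cite: AroraBarakCC2009, Thm. 6.6] -/
theorem collapseShrinksPermanent_of_collapseMakesPermanentEasy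
    (hK : CollapseMakesPermanentEasy) : CollapseShrinksPermanent := by
  unfold CollapseShrinksPermanent
  unfold CollapseMakesPermanentEasy at hK
  exact fun h => P_subset_PPoly_holds (hK h)

/-- **The crux `CollapseMakesPermanentEasy` (stmt-PneNP-16142) is EQUIVALENT to the support
`CollapseShrinksPermanent` (stmt-PneNP-16144)** now that uniformization is proved: the open content of the
crux is exactly "a polynomial-time SAT algorithm yields small circuits for the permanent". [folklore] -/
theorem collapseMakesPermanentEasy_iff_collapseShrinksPermanent :
    CollapseMakesPermanentEasy ↔ CollapseShrinksPermanent :=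
  ⟨collapseShrinksPermanent_of_collapseMakesPermanentEasy,
    collapseMakesPermanentEasy_of_collapseShrinksPermanent⟩

end Summit.PneNP.PneNP.Theorems
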